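import Literature.Probability.LatticeModels.UnitStepTrails
import Literature.Probability.LatticeModels.UnpredictablePairTails
import HarnessLib

/-!
# Random lattice paths inside the ball `B((x+y)/2, 2‖x−y‖)` in `ℤ^d`, `d ≥ 3`: frames and drift

Step 2 of the proof of Theorem 1.3 of Garban–Spencer (arXiv:2109.01617, p. 10: "one may travel
from any `x` to `y` using … directed cones … The (non-optimal) geometric condition
`B((x+y)/2, 2‖x−y‖₂) ⊂ Λ` is there only to ensure that the above cones remain inside `Λ`")
requires, for every pair `x ≠ y` of `ℤ^d`, a probability measure on simple nearest-neighbour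
paths from `x` to `y` inside that ball with the exponential-intersection-tails property.  The
source sketches a concatenation of four reflected cones of Benjamini–Pemantle–Peres paths; the
tree uses the following explicit single-leg construction driven by the randomness `PEnv T T` of
`UnpredictablePairTails` (two dyadic-velocity walks `S₀, S₁`):

* a **frame**: the axis `i₀` of largest displacement `|y_{i₀} − x_{i₀}| = T = ‖y − x‖_∞ ≥ 1`,
  its sign `σ`, and two further distinct axes `j₀, k₀` (this is where `d ≥ 3` enters);
* block `t = 0, …, T−1` moves first one step `σ e_{i₀}`, then adjusts every other coordinate
  `l` from `c_l(t)` to `c_l(t+1)`, where `c_l(t) = x_l + ⌊t (y_l − x_l)/T⌋ + [l = j₀] S₀(τ_t)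
  + [l = k₀] S₁(τ_t)` with the *reflected clock* `τ_t = min(t, T − t)` (so that the random part
  vanishes at both ends and the path ends exactly at `y`).

This file: the frame (`Frame`, `Frame.exists_of_ne`), the reflected clock `τ_t` and the
deterministic drift `⌊t v_l/T⌋` with its two properties (stays between `0` and `v_l`; moves by at
most one per block).  The skeleton, the vertex list and its properties are in `BallPathGeometry`,
the overlap bound in `BallPathOverlap`.

## References

* C. Garban, T. Spencer, arXiv:2109.01617, proof of Theorem 1.3, Step 2 (p. 10).
  [GarbanSpencer2022]
-/

noncomputable section

open Finset
open scoped BigOperators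

namespace Literature.Probability.LatticeModels

namespace BallPath

open Trail DyadicWalk

variable {d : ℕ}

/-! ### Frames -/

/-- A **frame** for the pair `(x, y)`: the axis `i₀` of maximal displacement and two further
pairwise distinct axes `j₀, k₀` (available since `d ≥ 3`). [folklore] -/
structure Frame (d : ℕ) where
  /-- start point -/
  x : Site d
  /-- end point -/
  y : Site d
  /-- axis of maximal displacement (the "time" axis) -/
  i₀ : Fin d
  /-- first random transverse axis -/
  j₀ : Fin d
  /-- second random transverse axis -/
  k₀ : Fin d
  /-- the first transverse axis is not the time axis -/
  hj : j₀ ≠ i₀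
  /-- the second transverse axis is not the time axis -/
  hk : k₀ ≠ i₀
  /-- the two transverse axes are distinct -/
  hjk : j₀ ≠ k₀
  /-- the time axis has maximal displacement -/
  hmax : ∀ i, |y i - x i| ≤ |y i₀ - x i₀|
  /-- the end points are distinct -/
  hne : x ≠ y

namespace Frame

variable (F : Frame d)

/-- The displacement `v = y − x`. [folklore] -/
def v : Site d := F.y - F.x

/-- The number of blocks `T = |v_{i₀}| = ‖v‖_∞`. [folklore] -/
def T : ℕ := (F.v F.i₀).natAbs

/-- The direction `σ = sign v_{i₀} ∈ {±1}` of the time axis. [folklore] -/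
def σ : ℤ := (F.v F.i₀).sign

/-- `v ≠ 0`. [folklore] -/
theorem v_ne_zero : F.v ≠ 0 := fun h => F.hne (eq_of_sub_eq_zero h).symm

/-- `|v_i| ≤ |v_{i₀}|`. [folklore] -/
theorem abs_v_le (i : Fin d) : |F.v i| ≤ |F.v F.i₀| := F.hmax i

/-- `T ≥ 1`. [folklore] -/
theorem T_pos : 0 < F.T := by
  obtain ⟨i, hi⟩ : ∃ i, F.v i ≠ 0 := by
    by_contra h
    push Not at h
    exact F.v_ne_zero (funext h)
  have h1 : 0 < |F.v i| := abs_pos.2 hi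
  have h2 := F.abs_v_le i
  unfold T
  have : 0 < |F.v F.i₀| := lt_of_lt_of_le h1 h2
  exact Int.natAbs_pos.2 (abs_pos.1 this)

/-- `v_{i₀} ≠ 0`. [folklore] -/
theorem v_i₀_ne_zero : F.v F.i₀ ≠ 0 := Int.natAbs_pos.1 F.T_pos

/-- `(T : ℤ) = |v_{i₀}|`. [folklore] -/
theorem T_eq_abs : (F.T : ℤ) = |F.v F.i₀| := Int.natCast_natAbs _

/-- `σ = ±1`. [folklore] -/
theorem σ_eq_or : F.σ = 1 ∨ F.σ = -1 := Trail.sign_eq_or F.v_i₀_ne_zero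

/-- `σ ≠ 0`. [folklore] -/
theorem σ_ne_zero : F.σ ≠ 0 := by rcases F.σ_eq_or with h | h <;> simp [h]

/-- `v_{i₀} = σ T`. [folklore] -/
theorem v_i₀_eq : F.v F.i₀ = F.σ * F.T := by
  rw [T_eq_abs, σ]; exact (Int.sign_mul_abs _).symm

/-- `|v_l| ≤ T`. [folklore] -/
theorem abs_v_le_T (l : Fin d) : |F.v l| ≤ F.T := by rw [T_eq_abs]; exact F.abs_v_le l

/-- **Frames exist** for every pair of distinct points when `d ≥ 3`. [folklore] -/
theorem exists_of_ne (hd : 3 ≤ d) {x y : Site d} (hne : x ≠ y) :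
    ∃ F : Frame d, F.x = x ∧ F.y = y := by
  have hd0 : 0 < d := by omega
  haveI : Nonempty (Fin d) := ⟨⟨0, hd0⟩⟩
  obtain ⟨i₀, -, hi₀⟩ := Finset.exists_max_image Finset.univ (fun i => |y i - x i|) Finset.univ_nonempty
  -- two further axes among the first three
  set a : Fin d := ⟨0, by omega⟩
  set b : Fin d := ⟨1, by omega⟩
  set c : Fin d := ⟨2, by omega⟩
  have hab : a ≠ b := by simp [a, b, Fin.ext_iff]
  have hac : a ≠ c := by simp [a, c, Fin.ext_iff]
  have hbc : b ≠ c := by simp [b, c, Fin.ext_iff]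
  by_cases h1 : i₀ = a
  · exact ⟨⟨x, y, i₀, b, c, by rw [h1]; exact hab.symm, by rw [h1]; exact hac.symm, hbc,
      fun i => hi₀ i (Finset.mem_univ i), hne⟩, rfl, rfl⟩
  · by_cases h2 : i₀ = b
    · exact ⟨⟨x, y, i₀, a, c, by rw [h2]; exact hab, by rw [h2]; exact hbc.symm, hac,
        fun i => hi₀ i (Finset.mem_univ i), hne⟩, rfl, rfl⟩
    · exact ⟨⟨x, y, i₀, a, b, Ne.symm h1, Ne.symm h2, hab,
        fun i => hi₀ i (Finset.mem_univ i), hne⟩, rfl, rfl⟩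

/-! ### The reflected clock and the drift -/

/-- The reflected clock `τ_t = min(t, T − t)`. [folklore] -/
def tau (t : ℕ) : ℕ := min t (F.T - t)

/-- `τ_t ≤ T`. [folklore] -/
theorem tau_le (t : ℕ) : F.tau t ≤ F.T := by unfold tau; omega

/-- `τ_0 = 0`. [folklore] -/
@[simp] theorem tau_zero : F.tau 0 = 0 := by simp [tau]

/-- `τ_T = 0`. [folklore] -/
@[simp] theorem tau_T : F.tau F.T = 0 := by simp [tau]

/-- The clock moves by at most one per block. [folklore] -/
theorem tau_succ (t : ℕ) : F.tau (t + 1) = F.tau t ∨ F.tau (t + 1) = F.tau t + 1 ∨ F.tau (t + 1) + 1 = F.tau t := by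
  unfold tau; omega

/-- The deterministic drift `⌊t v_l / T⌋` of the coordinate `l`. [folklore] -/
def drift (l : Fin d) (t : ℕ) : ℤ := ⌊(t : ℝ) * (F.v l : ℝ) / F.T⌋

/-- `drift l 0 = 0`. [folklore] -/
@[simp] theorem drift_zero (l : Fin d) : F.drift l 0 = 0 := by simp [drift]

/-- `drift l T = v_l`. [folklore] -/
@[simp] theorem drift_T (l : Fin d) : F.drift l F.T = F.v l := by
  have hT : (F.T : ℝ) ≠ 0 := by exact_mod_cast F.T_pos.ne'
  rw [drift, show ((F.T : ℕ) : ℝ) * (F.v l : ℝ) / F.T = ((F.v l : ℤ) : ℝ) by field_simp]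
  exact Int.floor_intCast _

/-- Along the time axis the drift is exact: `drift i₀ t = σ t`. [folklore] -/
theorem drift_i₀ (t : ℕ) : F.drift F.i₀ t = F.σ * t := by
  have hT : (F.T : ℝ) ≠ 0 := by exact_mod_cast F.T_pos.ne'
  rw [drift, v_i₀_eq]
  push_cast
  rw [show (t : ℝ) * (F.σ * F.T) / F.T = ((F.σ * t : ℤ) : ℝ) by push_cast; field_simp]
  exact Int.floor_intCast _

/-- **The drift stays between `0` and `v_l`** for `t ≤ T`. [folklore] -/
theorem drift_mem_uIcc (l : Fin d) {t : ℕ} (ht : t ≤ F.T) : F.drift l t ∈ Set.uIcc 0 (F.v l) := by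
  have hT : (0 : ℝ) < F.T := by exact_mod_cast F.T_pos
  have h01 : (0 : ℝ) ≤ t / F.T ∧ (t : ℝ) / F.T ≤ 1 :=
    ⟨by positivity, by rw [div_le_one hT]; exact_mod_cast ht⟩
  have e : (t : ℝ) * (F.v l : ℝ) / F.T = (t / F.T) * F.v l := by ring
  unfold drift
  rw [e]
  rcases le_total 0 (F.v l) with hv | hv
  · rw [Set.uIcc_of_le hv, Set.mem_Icc]
    have hv' : (0 : ℝ) ≤ F.v l := by exact_mod_cast hv
    constructor
    · exact Int.floor_nonneg.2 (mul_nonneg h01.1 hv')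
    · have : (t : ℝ) / F.T * F.v l ≤ F.v l := by nlinarith
      have := Int.floor_mono this
      rwa [Int.floor_intCast] at this
  · rw [Set.uIcc_of_ge hv, Set.mem_Icc]
    have hv' : (F.v l : ℝ) ≤ 0 := by exact_mod_cast hv
    constructor
    · have : (F.v l : ℝ) ≤ (t : ℝ) / F.T * F.v l := by nlinarith
      have := Int.floor_mono this
      rwa [Int.floor_intCast] at this
    · have : (t : ℝ) / F.T * F.v l ≤ 0 := mul_nonpos_of_nonneg_of_nonpos h01.1 hv'  -- hmm name
      have := Int.floor_mono this
      simpa using this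

/-- **The drift moves by at most one per block** (`|v_l| ≤ T`). [folklore] -/
theorem abs_drift_succ_sub_le (l : Fin d) (t : ℕ) : |F.drift l (t + 1) - F.drift l t| ≤ 1 := by
  have hT : (0 : ℝ) < F.T := by exact_mod_cast F.T_pos
  have hstep : |((t + 1 : ℕ) : ℝ) * (F.v l : ℝ) / F.T - (t : ℝ) * (F.v l : ℝ) / F.T| ≤ 1 := by
    rw [show ((t + 1 : ℕ) : ℝ) * (F.v l : ℝ) / F.T - (t : ℝ) * (F.v l : ℝ) / F.T = (F.v l : ℝ) / F.T by
      push_cast; ring]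
    rw [abs_div, abs_of_pos hT, div_le_one hT]
    have := F.abs_v_le_T l
    exact_mod_cast this
  unfold drift
  set a : ℝ := (t : ℝ) * (F.v l : ℝ) / F.T
  set b : ℝ := ((t + 1 : ℕ) : ℝ) * (F.v l : ℝ) / F.T
  rw [abs_le] at hstep ⊢
  obtain ⟨h1, h2⟩ := hstep
  constructor
  · -- ⌊a⌋ ≤ ⌊b⌋ + 1
    have ha := Int.floor_le a
    have hb := Int.lt_floor_add_one b
    have h' : (⌊a⌋ : ℝ) < ((⌊b⌋ + 2 : ℤ) : ℝ) := by push_cast; linarith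
    have := Int.cast_lt.1 h'
    omega
  · have ha := Int.lt_floor_add_one a
    have hb := Int.floor_le b
    have : (⌊b⌋ : ℝ) < ⌊a⌋ + 1 + 1 := by linarith
    have h' : (⌊b⌋ : ℝ) < ((⌊a⌋ + 2 : ℤ) : ℝ) := by push_cast; linarith
    have := Int.cast_lt.1 h'
    omega

end Frame

end BallPath

end Literature.Probability.LatticeModels
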